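import Mathlib
import HarnessLib
import Summits.HubbardSuperconductivity.HubbardSuperconductivity.Theorems.KLProgrammeH10TwoPointLimitKlAnisoLastLegCount
import Summits.HubbardSuperconductivity.HubbardSuperconductivity.Theorems.KLProgrammeH10TwoPointLimitSectorMultiplierFat
import Summits.HubbardSuperconductivity.HubbardSuperconductivity.Theorems.KLProgrammeKLRegimeSplitLegCount

/-!
# Route `KLProgramme` — K3 engine child `KLRegimeEngineV17F2` (stmt-HubbardSuperconductivity-20437), stub (b) `(Hμ)` re-sectorisation:
# THE UMKLAPP SPLITTER — off the umklapp-active class of COARSE label tuples, every admissible fine refinement conserves momentum IN `ℝ²`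

Cell gate-hubbard-kl, seat p4 (C5a), g11.  The correlated re-sectorisation lemma of k3c2-p3
(`EngineV8.hubbardSectorKernelNorm_klAniso_jump_le_of_relCount_split`, `…PrescribedSum…_split`) splits the coarse (`klAnisoFamily k`) label tuples
`σ′` into a class `B` (count `R₂`) and its complement (count `R₁`); the intended `B` (E1-TOWER-BLOCKED §10, p4 COUNTING-NOTE-2) is the UMKLAPP-ACTIVE
class: the coarse tuples whose signed frame Fermi points at the sector centres sum to within `O((m+1)·w_k)` of a NON-ZERO reciprocal vector `2πG`.
This file proves the property that makes the split work, uniformly in the frame: OFF that class, for every fine tuple `σ″` (any `klAnisoFamily J′`,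
`J′ ≥ k ≥ k₀`) refining `σ′` leg by leg (support overlap with the fat multiplier, same spin and charge) and every choice of torus momenta in the
supports of `σ″` conserving momentum on `(ℤ/Lℤ)²`, the signed centred representatives sum to ZERO IN `ℝ²` (the reciprocal vector of
`exists_sum_signed_torusCentredMomentum_eq` vanishes) — so that off `B` the relative count is the continuum one (BGM 2003 Lemma 3.1 (4.3), proved for
every admissible frame in `…FrameBGM2003SectorCounting`), and ON `B` the last-leg row `EngineV8.card_relCount_prescribed_lastLeg_klAniso_le` applies:

* `abs_rep_sub_fermiPoint_le_of_overlap` — a momentum in the support of `klAnisoFamily J′ ω″`, where `ω″` overlaps the fat multiplier of the coarse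
  label `ω′` (scale `k ≤ J′`), is within `C·w_k` of the frame's Fermi point at the COARSE centre `θ_{k,ω′}` (coordinatewise);
* **`sum_signedReps_eq_zero_of_offUmklapp_frame`** / **`…_frameOK`** — the splitter, for frames with `4A ≤ κ` / in the KL regime.

Everything is PROVED; no definitions (the class is written inline), no named facts.  References: BGM 2006 §2.7 (2.66)–(2.71), §2.8 (2.73), App. A3
[cite: BenfattoGiulianiMastropietro2006]; BGM 2003 §7.4 [cite: BenfattoGiulianiMastropietro2003]; HOME/prover-p4/COUNTING-NOTE-2.md §0–§2.
-/

noncomputable section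

namespace Summit.HubbardSuperconductivity.HubbardSuperconductivity.Theorems.PerturbedFermiCurve

set_option linter.dupNamespace false -- summit = problem name (single-conjunct summit), D-0017

open Classical
open Real Set Finset
open Literature.MathematicalPhysics.QuantumLattice Literature.MathematicalPhysics.QuantumLattice.BandSectorCounting
open Literature.Probability.LatticeModels
open Summit.HubbardSuperconductivity.HubbardSuperconductivity.Theorems.DispersionFlow
open Summit.HubbardSuperconductivity.HubbardSuperconductivity.Theorems.KLRegimeSplit
open Summit.HubbardSuperconductivity.HubbardSuperconductivity.Theorems.KLProgrammeLegKernels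
open Summit.HubbardSuperconductivity.HubbardSuperconductivity.Theorems.TorusFourierL2

/-! ## §1 A fine support point near the COARSE centre -/

/-- **Angular localisation through an overlap**: if `q` and `q₀` both carry the thin multiplier `klAnisoFamily … J′ ω″` and `q₀` carries the fat
multiplier of index `k ≤ J′` and label `ω′`, then the polar angle of `q` is within `(13/4)·w_k` of the COARSE centre `θ_{k,ω′}` modulo `2π`.
[cite: BenfattoGiulianiMastropietro2006, §2.7 (2.66)–(2.71)] -/
theorem exists_abs_angle_sub_coarseCenter_le (L M : ℕ) {β μ : ℝ} {K : TrigPolyC4v} {k J' : ℕ} (hkJ : k ≤ J')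
    {ω'' : Fin (sectorCount J')} {ω' : Fin (sectorCount k)} {q q₀ : FreqMomentum L M}
    (hq : klAnisoFamily L M β μ K klE0 J' ω'' q ≠ 0) (hq₀ : klAnisoFamily L M β μ K klE0 J' ω'' q₀ ≠ 0)
    (hq₀' : bgmFatMultiplier L M klE0 β (nambuXiCT L μ K) k ω' q₀ ≠ 0) :
    ∃ mz : ℤ, |momentumAngle L q.2 + mz * (2 * π) - sectorCenter k ω'| ≤ 13 / 4 * sectorWidth k := by
  have he : (0 : ℝ) < klE0 := by norm_num [klE0]
  have hwk : 0 < sectorWidth k := sectorWidth_pos k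
  have hww : sectorWidth J' ≤ sectorWidth k := by
    rw [sectorWidth_eq_pow_mul hkJ]
    exact le_mul_of_one_le_left (sectorWidth_pos J').le (one_le_pow₀ (by norm_num))
  have hNw : (sectorCount k : ℝ) * sectorWidth k = 2 * π := sectorCount_mul_sectorWidth k
  -- fine support inequalities for `q` and `q₀`
  obtain ⟨-, -, h3⟩ := support_klAnisoFamily L M he β μ K J' ω'' q hq
  obtain ⟨-, -, h3₀⟩ := support_klAnisoFamily L M he β μ K J' ω'' q₀ hq₀
  obtain ⟨k₁, hk₁⟩ := exists_abs_lt_of_sectorWeightCirc_ne_zero h3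
  obtain ⟨k₂, hk₂⟩ := exists_abs_lt_of_sectorWeightCirc_ne_zero h3₀
  -- coarse support inequality for `q₀` through a fat neighbour
  obtain ⟨a, ⟨d, hd, hdvd⟩, ha⟩ := exists_fatNbr_of_bgmFatMultiplier_ne_zero klE0 β (nambuXiCT L μ K) k ω' q₀ hq₀'
  obtain ⟨k₃, hk₃⟩ := exists_abs_lt_of_sectorWeightCirc_ne_zero ha
  obtain ⟨t, ht⟩ := hdvd
  push_cast at hk₁ hk₂ hk₃
  -- centre of `a` versus centre of `ω′`: `a·w = ω′·w + d·w + t·2π`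
  have hcast : ((a : ℕ) : ℝ) - ((ω' : ℕ) : ℝ) - (d : ℝ) = (sectorCount k : ℝ) * (t : ℝ) := by
    have h' : ((((a : ℕ) : ℤ) - ((ω' : ℕ) : ℤ) - d : ℤ) : ℝ) = (((sectorCount k : ℤ) * t : ℤ) : ℝ) := by rw [ht]
    push_cast at h'
    exact h'
  have hcen : ((a : ℕ) : ℝ) * sectorWidth k = ((ω' : ℕ) : ℝ) * sectorWidth k + (d : ℝ) * sectorWidth k + (t : ℝ) * (2 * π) := by
    rw [← hNw]
    linear_combination sectorWidth k * hcast
  have hd' : |(d : ℝ)| ≤ 1 := by exact_mod_cast hd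
  have hdw : |(d : ℝ) * sectorWidth k| ≤ sectorWidth k := by
    rw [abs_mul, abs_of_pos hwk]; nlinarith
  refine ⟨-(k₁ - k₂ + k₃ + t), ?_⟩
  rw [sectorCenter]
  -- the four pieces
  have e : momentumAngle L q.2 + ((-(k₁ - k₂ + k₃ + t) : ℤ) : ℝ) * (2 * π) - (((ω' : ℕ) : ℝ) + 1 / 2) * sectorWidth k =
      (momentumAngle L q.2 - (((ω'' : ℕ) : ℝ) + 1 / 2) * sectorWidth J' - 2 * π * (k₁ : ℝ)) -
      (momentumAngle L q₀.2 - (((ω'' : ℕ) : ℝ) + 1 / 2) * sectorWidth J' - 2 * π * (k₂ : ℝ)) +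
      (momentumAngle L q₀.2 - (((a : ℕ) : ℝ) + 1 / 2) * sectorWidth k - 2 * π * (k₃ : ℝ)) + (d : ℝ) * sectorWidth k := by
    push_cast
    linear_combination hcen
  rw [e]
  have hX := hk₁.le
  have hY := hk₂.le
  have hZ := hk₃.le
  have h4 : ∀ X Y Z W : ℝ, |X - Y + Z + W| ≤ |X| + |Y| + |Z| + |W| := fun X Y Z W => by
    have h1 : |X - Y + Z + W| ≤ |X - Y + Z| + |W| := abs_add_le _ _
    have h2 : |X - Y + Z| ≤ |X - Y| + |Z| := abs_add_le _ _
    have h3 : |X - Y| ≤ |X| + |Y| := abs_sub _ _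
    linarith
  refine (h4 _ _ _ _).trans ?_
  linarith

section Frame

variable {a b : ℝ} (B : BandBounds a b) {K : TrigPolyC4v} {A : ℝ}
  (hA : ∀ p : Momentum, ∀ j ≤ 2, ‖iteratedFDeriv ℝ j (frameShift K) p‖ ≤ A) (hADt : 2 * A < B.Dtmin) {μ : ℝ}
include B hA hADt

/-- **A fine support point through an overlap sits in a cell around the frame's Fermi point at the COARSE centre**: with `q, q₀` as in
`exists_abs_angle_sub_coarseCenter_le` and the shell `Λ_k = klScale klE0 k` inside the level range (`a ≤ μ − A − Λ_k`, `μ + A + Λ_k ≤ b`):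
`|c(q)_i − klFermiPoint μ K θ_{k,ω′} i| ≤ (Λ_k + s_max Dt_min (13/4) w_k)/(Dt_min − 2A)`. [cite: BenfattoGiulianiMastropietro2006, §2.7 (2.69)–(2.71)] -/
theorem abs_rep_sub_fermiPoint_le_of_overlap (L M : ℕ) {β : ℝ} {k J' : ℕ} (hkJ : k ≤ J')
    (hlo : a ≤ μ - A - klScale klE0 k) (hhi : μ + A + klScale klE0 k ≤ b)
    {ω'' : Fin (sectorCount J')} {ω' : Fin (sectorCount k)} {q q₀ : FreqMomentum L M}
    (hq : klAnisoFamily L M β μ K klE0 J' ω'' q ≠ 0) (hq₀ : klAnisoFamily L M β μ K klE0 J' ω'' q₀ ≠ 0)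
    (hq₀' : bgmFatMultiplier L M klE0 β (nambuXiCT L μ K) k ω' q₀ ≠ 0) (i : Fin 2) :
    |torusCentredMomentum L q.2 i - klFermiPoint μ K (sectorCenter k ω') i| ≤
      (klScale klE0 k + B.smax * B.Dtmin * (13 / 4 * sectorWidth k)) / (B.Dtmin - 2 * A) := by
  have he : (0 : ℝ) < klE0 := by norm_num [klE0]
  obtain ⟨h1, -, -⟩ := support_klAnisoFamily L M he β μ K J' ω'' q hq
  rw [nambuXiCT_eq_frameLevel] at h1
  have hshell : |frameLevel μ K (WithLp.toLp 2 (torusCentredMomentum L q.2))| ≤ klScale klE0 k :=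
    h1.le.trans (klld_klScale_anti hkJ)
  obtain ⟨mz, hmz⟩ := exists_abs_angle_sub_coarseCenter_le L M hkJ hq hq₀ hq₀'
  rw [momentumAngle_eq_arg] at hmz
  exact frame_cell B hA hADt (abs_torusCentredMomentum_le_pi L q.2) hshell hlo hhi hmz i

end Frame

/-! ## §2 The splitter -/

/-- **OFF THE UMKLAPP-ACTIVE CLASS, EVERY ADMISSIBLE REFINEMENT CONSERVES MOMENTUM IN `ℝ²` (frames of small `C²` size).**  For every level window
`[μ₁, μ₂] ⊂ (-4, 0)` there are `κ, C > 0` and a scale `k₀` such that for every frame `K` with `4A ≤ κ`, every `μ ∈ [μ₁, μ₂]`, torus `L`, cutoff `M`,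
`β`, scales `k₀ ≤ k ≤ J′`, every coarse tuple `σ′` (index `k`) OFF the class — i.e. for every reciprocal vector `G ≠ 0` some coordinate of
`Σ_i ±klFermiPoint μ K θ_{k,σ′ i} − 2πG` exceeds `(m+1)·C·w_k` in absolute value (signs = charges) —, every fine tuple `σ″` (index `J′`) refining `σ′`
leg by leg, and every family of torus momenta in the supports of `σ″` conserving momentum on `(ℤ/Lℤ)²`: the signed centred representatives sum to
`0 ∈ ℝ²`. [cite: BenfattoGiulianiMastropietro2006, §2.8 (2.73), App. A3] -/
theorem sum_signedReps_eq_zero_of_offUmklapp_frame :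
    ∀ μ₁ μ₂ : ℝ, -4 < μ₁ → μ₁ ≤ μ₂ → μ₂ < 0 → ∃ κ : ℝ, 0 < κ ∧ ∃ C : ℝ, 0 < C ∧ ∃ k₀ : ℕ,
      ∀ (K : TrigPolyC4v) (A : ℝ), (∀ p : Momentum, ∀ j ≤ 2, ‖iteratedFDeriv ℝ j (frameShift K) p‖ ≤ A) → 4 * A ≤ κ →
      ∀ μ ∈ Set.Icc μ₁ μ₂, ∀ (L M : ℕ) [NeZero L] (β : ℝ) (m k J' : ℕ), k₀ ≤ k → k ≤ J' →
      ∀ (σ' : Fin (m + 1) → SectorLeg (sectorCount k)) (σ'' : Fin (m + 1) → SectorLeg (sectorCount J')),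
      (∀ i, (∃ q : FreqMomentum L M, klAnisoFamily L M β μ K klE0 J' (σ'' i).1.1 q ≠ 0 ∧
          bgmFatMultiplier L M klE0 β (nambuXiCT L μ K) k (σ' i).1.1 q ≠ 0) ∧ (σ' i).1.2 = (σ'' i).1.2 ∧ (σ' i).2 = (σ'' i).2) →
      (∀ G : Fin 2 → ℤ, G ≠ 0 → ∃ j : Fin 2, ((m : ℝ) + 1) * C * sectorWidth k <
          |∑ i, (if (σ' i).2 = 0 then klFermiPoint μ K (sectorCenter k (σ' i).1.1) j
              else -klFermiPoint μ K (sectorCenter k (σ' i).1.1) j) - 2 * π * (G j : ℝ)|) →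
      ∀ kf : Fin (m + 1) → FreqMomentum L M, (∀ i, klAnisoFamily L M β μ K klE0 J' (σ'' i).1.1 (kf i) ≠ 0) →
        ∑ i, signedMomentum L (σ'' i).2 (kf i).2 = 0 →
        ∀ j : Fin 2, ∑ i, (if (σ'' i).2 = 0 then torusCentredMomentum L (kf i).2 j else -torusCentredMomentum L (kf i).2 j) = 0 := by
  intro μ₁ μ₂ hμ₁ h12 hμ₂
  have ha : -4 < (μ₁ - 4) / 2 := by linarith
  have hab : (μ₁ - 4) / 2 ≤ μ₂ / 2 := by linarith
  have hb : μ₂ / 2 < 0 := by linarith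
  obtain ⟨B, -⟩ : ∃ B : BandBounds ((μ₁ - 4) / 2) (μ₂ / 2), B = bandBounds ha hab hb := ⟨_, rfl⟩
  obtain ⟨m₀, hm₀def⟩ : ∃ m₀ : ℝ, m₀ = min (μ₁ - (μ₁ - 4) / 2) (μ₂ / 2 - μ₂) := ⟨_, rfl⟩
  have hm₀ : 0 < m₀ := by rw [hm₀def]; exact lt_min (by linarith) (by linarith)
  have hm1 : m₀ ≤ μ₁ - (μ₁ - 4) / 2 := by rw [hm₀def]; exact min_le_left _ _
  have hm2 : m₀ ≤ μ₂ / 2 - μ₂ := by rw [hm₀def]; exact min_le_right _ _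
  have hDt := B.Dtmin_pos; have hs := B.smax_pos; have hπ := Real.pi_pos
  have he : (0 : ℝ) < klE0 := by norm_num [klE0]
  -- the scale threshold: `Λ_{k₀} ≤ m₀/2`
  obtain ⟨k₀, hk₀⟩ : ∃ k₀ : ℕ, klScale klE0 k₀ ≤ m₀ / 2 := by
    obtain ⟨k₀, hk₀⟩ := exists_pow_lt_of_lt_one (show 0 < m₀ / 2 / klE0 by positivity) (show (4 : ℝ)⁻¹ < 1 by norm_num)
    refine ⟨k₀, ?_⟩
    unfold klScale
    rw [← inv_pow]
    have := (lt_div_iff₀ he).1 hk₀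
    linarith [mul_comm ((4 : ℝ)⁻¹ ^ k₀) klE0]
  obtain ⟨C, hC⟩ : ∃ C : ℝ, C = 2 * (klE0 / π + B.smax * B.Dtmin * (13 / 4)) / B.Dtmin := ⟨_, rfl⟩
  have hC0 : 0 < C := by rw [hC]; positivity
  refine ⟨min (B.Dtmin / 2) (m₀ / 2), lt_min (by positivity) (by positivity), C, hC0, k₀, ?_⟩
  intro K A hA hAκ μ hμ L M _ β m k J' hk₀k hkJ σ' σ'' hover hoff kf hkF hsum j
  have hA0 : 0 ≤ A := le_trans (norm_nonneg _) (hA 0 0 (by norm_num))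
  have hκD : 4 * A ≤ B.Dtmin / 2 := hAκ.trans (min_le_left _ _)
  have hκm : 4 * A ≤ m₀ / 2 := hAκ.trans (min_le_right _ _)
  have hA2 : 2 * A < B.Dtmin := by linarith
  have hΛ : klScale klE0 k ≤ m₀ / 2 := (klld_klScale_anti hk₀k).trans hk₀
  have hlo : (μ₁ - 4) / 2 ≤ μ - A - klScale klE0 k := by linarith [hμ.1]
  have hhi : μ + A + klScale klE0 k ≤ μ₂ / 2 := by linarith [hμ.2]
  have hwk : 0 < sectorWidth k := sectorWidth_pos k
  have hwπ : sectorWidth k ≤ π := sectorWidth_le_pi k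
  -- the cell radius at the coarse centre is `≤ C·w_k`
  have hden : B.Dtmin / 2 ≤ B.Dtmin - 2 * A := by linarith
  have hrad : (klScale klE0 k + B.smax * B.Dtmin * (13 / 4 * sectorWidth k)) / (B.Dtmin - 2 * A) ≤ C * sectorWidth k := by
    have hkl : klScale klE0 k ≤ klE0 / π * sectorWidth k := by
      rw [klScale_eq_mul_sectorWidth_sq, div_mul_eq_mul_div, div_mul_eq_mul_div, div_le_div_iff₀ (by positivity) (by positivity)]
      calc klE0 * sectorWidth k ^ 2 * π = (klE0 * sectorWidth k * π) * sectorWidth k := by ring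
        _ ≤ (klE0 * sectorWidth k * π) * π := mul_le_mul_of_nonneg_left hwπ (by positivity)
        _ = klE0 * sectorWidth k * π ^ 2 := by ring
    have hnum : klScale klE0 k + B.smax * B.Dtmin * (13 / 4 * sectorWidth k) ≤ (klE0 / π + B.smax * B.Dtmin * (13 / 4)) * sectorWidth k := by
      rw [add_mul]; linarith
    have h1 : (klScale klE0 k + B.smax * B.Dtmin * (13 / 4 * sectorWidth k)) / (B.Dtmin - 2 * A) ≤
        (klE0 / π + B.smax * B.Dtmin * (13 / 4)) * sectorWidth k / (B.Dtmin / 2) :=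
      div_le_div₀ (by positivity) hnum (by positivity) hden
    have e : (klE0 / π + B.smax * B.Dtmin * (13 / 4)) * sectorWidth k / (B.Dtmin / 2) = C * sectorWidth k := by
      rw [hC, div_eq_iff (by positivity)]
      field_simp
    linarith [h1, e]
  -- every signed representative is within `C·w_k` of the signed coarse Fermi point
  have hleg : ∀ i, |(if (σ'' i).2 = 0 then torusCentredMomentum L (kf i).2 j else -torusCentredMomentum L (kf i).2 j) -
      (if (σ' i).2 = 0 then klFermiPoint μ K (sectorCenter k (σ' i).1.1) j else -klFermiPoint μ K (sectorCenter k (σ' i).1.1) j)| ≤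
        C * sectorWidth k := by
    intro i
    obtain ⟨⟨q₀, hq₀, hq₀'⟩, -, hc⟩ := hover i
    have h := (abs_rep_sub_fermiPoint_le_of_overlap B hA hA2 L M hkJ hlo hhi (hkF i) hq₀ hq₀' j).trans hrad
    rw [← hc]
    split_ifs
    · exact h
    · have e : -torusCentredMomentum L (kf i).2 j - -klFermiPoint μ K (sectorCenter k (σ' i).1.1) j =
          -(torusCentredMomentum L (kf i).2 j - klFermiPoint μ K (sectorCenter k (σ' i).1.1) j) := by ring
      rw [e, abs_neg]; exact h
  -- the reciprocal vector
  obtain ⟨G, hG⟩ := exists_sum_signed_torusCentredMomentum_eq L (fun i => (σ'' i).2) (fun i => (kf i).2) hsum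
  by_cases hG0 : G = 0
  · rw [hG j, hG0]; simp
  · exfalso
    obtain ⟨j', hj'⟩ := hoff G hG0
    have hclose : |∑ i, (if (σ' i).2 = 0 then klFermiPoint μ K (sectorCenter k (σ' i).1.1) j'
        else -klFermiPoint μ K (sectorCenter k (σ' i).1.1) j') - 2 * π * (G j' : ℝ)| ≤ ((m : ℝ) + 1) * C * sectorWidth k := by
      rw [← hG j', ← Finset.sum_sub_distrib]
      refine (Finset.abs_sum_le_sum_abs _ _).trans ?_
      have hleg' : ∀ i, |(if (σ' i).2 = 0 then klFermiPoint μ K (sectorCenter k (σ' i).1.1) j'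
          else -klFermiPoint μ K (sectorCenter k (σ' i).1.1) j') -
          (if (σ'' i).2 = 0 then torusCentredMomentum L (kf i).2 j' else -torusCentredMomentum L (kf i).2 j')| ≤ C * sectorWidth k := by
        intro i
        rw [abs_sub_comm]
        obtain ⟨⟨q₀, hq₀, hq₀'⟩, -, hc⟩ := hover i
        have h := (abs_rep_sub_fermiPoint_le_of_overlap B hA hA2 L M hkJ hlo hhi (hkF i) hq₀ hq₀' j').trans hrad
        rw [← hc]
        split_ifs
        · exact h
        · have e : -torusCentredMomentum L (kf i).2 j' - -klFermiPoint μ K (sectorCenter k (σ' i).1.1) j' =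
              -(torusCentredMomentum L (kf i).2 j' - klFermiPoint μ K (sectorCenter k (σ' i).1.1) j') := by ring
          rw [e, abs_neg]; exact h
      calc ∑ i, |(if (σ' i).2 = 0 then klFermiPoint μ K (sectorCenter k (σ' i).1.1) j'
            else -klFermiPoint μ K (sectorCenter k (σ' i).1.1) j') -
            (if (σ'' i).2 = 0 then torusCentredMomentum L (kf i).2 j' else -torusCentredMomentum L (kf i).2 j')|
          ≤ ∑ _i : Fin (m + 1), C * sectorWidth k := Finset.sum_le_sum fun i _ => hleg' i
        _ = ((m : ℝ) + 1) * C * sectorWidth k := by simp; ring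
    linarith

/-- **The splitter ON EVERY ADMISSIBLE FRAME IN THE KL REGIME.** [cite: BenfattoGiulianiMastropietro2006, §2.8 (2.73), App. A3] -/
theorem sum_signedReps_eq_zero_of_offUmklapp_frameOK :
    ∀ μ₁ μ₂ : ℝ, -4 < μ₁ → μ₁ ≤ μ₂ → μ₂ < 0 → ∃ C : ℝ, 0 < C ∧ ∃ k₀ : ℕ, ∀ R : RenConsts, (∀ j, 0 ≤ R.Gfr j) →
      ∃ c₃ : ℝ, 0 < c₃ ∧ ∃ U₀ : ℝ, 0 < U₀ ∧
      ∀ c : ℝ, 0 < c → c ≤ c₃ → ∀ U : ℝ, 0 < U → U ≤ U₀ → ∀ β : ℝ, klBetaMin ≤ β → β ≤ Real.exp (c / U ^ 2) →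
      ∀ μ ∈ Set.Icc μ₁ μ₂, ∀ (ν : ℝ) (K : TrigPolyC4v), FrameOK R U (nScales β) ν K →
      ∀ (L M : ℕ) [NeZero L] (m k J' : ℕ), k₀ ≤ k → k ≤ J' →
      ∀ (σ' : Fin (m + 1) → SectorLeg (sectorCount k)) (σ'' : Fin (m + 1) → SectorLeg (sectorCount J')),
      (∀ i, (∃ q : FreqMomentum L M, klAnisoFamily L M β μ K klE0 J' (σ'' i).1.1 q ≠ 0 ∧
          bgmFatMultiplier L M klE0 β (nambuXiCT L μ K) k (σ' i).1.1 q ≠ 0) ∧ (σ' i).1.2 = (σ'' i).1.2 ∧ (σ' i).2 = (σ'' i).2) →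
      (∀ G : Fin 2 → ℤ, G ≠ 0 → ∃ j : Fin 2, ((m : ℝ) + 1) * C * sectorWidth k <
          |∑ i, (if (σ' i).2 = 0 then klFermiPoint μ K (sectorCenter k (σ' i).1.1) j
              else -klFermiPoint μ K (sectorCenter k (σ' i).1.1) j) - 2 * π * (G j : ℝ)|) →
      ∀ kf : Fin (m + 1) → FreqMomentum L M, (∀ i, klAnisoFamily L M β μ K klE0 J' (σ'' i).1.1 (kf i) ≠ 0) →
        ∑ i, signedMomentum L (σ'' i).2 (kf i).2 = 0 →
        ∀ j : Fin 2, ∑ i, (if (σ'' i).2 = 0 then torusCentredMomentum L (kf i).2 j else -torusCentredMomentum L (kf i).2 j) = 0 := by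
  intro μ₁ μ₂ hμ₁ h12 hμ₂
  obtain ⟨κ, hκ, C, hC, k₀, h⟩ := sum_signedReps_eq_zero_of_offUmklapp_frame μ₁ μ₂ hμ₁ h12 hμ₂
  refine ⟨C, hC, k₀, fun R hR => ?_⟩
  obtain ⟨c₃, hc₃, U₀, hU₀, hthr⟩ := frame_thresholds hR hκ
  refine ⟨c₃, hc₃, U₀, hU₀, ?_⟩
  intro c hc hcle U hU hUle β hβmin hβc μ hμ ν K hK L M _ m k J' hk₀k hkJ σ' σ'' hover hoff kf hkF hsum j
  exact h K _ (fun p j hj => norm_iteratedFDeriv_frameShift_le_of_frameOK_regime hR hc.le hβmin hβc hK p hj)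
    (hthr c U hc.le hcle hU hUle) μ hμ L M β m k J' hk₀k hkJ σ' σ'' hover hoff kf hkF hsum j

end Summit.HubbardSuperconductivity.HubbardSuperconductivity.Theorems.PerturbedFermiCurve

end
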